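import Summits.QuantumFields.YangMills.Theorems.AlphaInputsT3ACv3Histories
import Summits.QuantumFields.YangMills.Theorems.UnitScaleTiltFluctuationComparisonRegPrRepAtHeightsWinRow
import HarnessLib

/-!
# `AlphaInputsT3ACv3Rows` — THE v3 SOCKET'S NAMED ROWS FOR THE TWO CRUX LINES (owner RULING g18-№3 §3 (iv)): STUB 2″ clause (d) `ZtermSize` at the v3 datum
# (`κZ := 𝔠.Alf`), and for crux 19935's (A)-chain the (β) rows of the v3 record BY NAME — the lower row `Fibre57LowAC` at every step and the MASS-FREE
# TRIVIAL-HISTORY ROW (print's (55) at `h′ = triv`: no mass, no transported `1`) in ★19201-p2's `hrow` shape — lane `pub-balaban3d`, seat alpha-1 (g3)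

All PROVED given only `h : OfV3At F 𝔠 a₀ a₁` (OPEN hypothesis schema, never asserted): `OfV3At.dataT3v3_Zterm_eq`, `OfV3At.dataT3v3_ztermSize` (2″ (d), the proof of
`OfV2At.dataT3c_ztermSize` at the v3 record), `PkgAtV3.fibre57Low` (projection), `PkgAtV3.fibre55Triv` (`LogComparisonRepAtHeights.fibre55Triv_of_fibre55WinAC` on the
projected row `PkgAtV3.fibre55Win` at `triv′`), `OfV3At.fibre55TrivRows` (the same for the chosen record of every run `K`, every step `k < K`: the `hrow` of
`OfV2At.repAtHeights_dataT3c_of_fibre55Triv` with `pkgAtV2 ↦ pkgAtV3`).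

References: T. Bałaban, Commun. Math. Phys. 102 (1985) 255–275 [Balaban1985UV3] ((41) p.266, (47) p.267, (55)–(58) pp.269–270, p.272 L32–33).
-/

set_option autoImplicit false

noncomputable section

namespace Summit.QuantumFields.YangMills.Theorems

open MeasureTheory Filter
open scoped BigOperators
open Literature.MathematicalPhysics.QuantumFieldTheory.Balaban1983to89
open Literature.MathematicalPhysics.QuantumFieldTheory.Balaban1983to89.AveragingRT (rnTransport)
open Literature.MathematicalPhysics.QuantumFieldTheory.Balaban1983to89.T3ContinuumYM3Torus
open Literature.MathematicalPhysics.QuantumFieldTheory.Balaban1983to89.T3AlphaInputsAC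
open Literature.MathematicalPhysics.QuantumFieldTheory.Balaban1983to89.B10Eq38TorusDomains (toFine)
open Literature.MathematicalPhysics.QuantumFieldTheory.Balaban1985CMP102
open Literature.MathematicalPhysics.QuantumFieldTheory.Balaban1985CMP102.Setting
open Summit.QuantumFields.Balaban3D.Carriers
open Summit.QuantumFields.Balaban3D.Proofs.Primitives
open Summit.QuantumFields.Balaban3D.Proofs.ScalesArithmetic (gk_pos gk_le_one)
open Summit.QuantumFields.Balaban3D.Proofs.TowerAC
open Summit.QuantumFields.Balaban3D.Proofs.StandardAC
open Summit.QuantumFields.Balaban3D.Proofs.InputsAC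
open Summit.QuantumFields.Balaban3D.Proofs.Bound55Masses (chiB)

/-! ## §1 STUB 2″ clause (d): the size of the large-field term at the v3 datum -/

section Zterm

variable {F : T3Family} {𝔠 : AlphaConsts F.L (suGroupModel 2).N} {a₀ a₁ : ℝ}
  (h : AlphaInputsT3AC.OfV3At F 𝔠 a₀ a₁) (hc : 0 < a₀ ∧ 0 < a₁ ∧ 𝔠.B₃ * a₁ ≤ a₀) (γ : ℝ) (hγ : 0 < γ)
  (hγ1 : γ ≤ (min 𝔠.gamma0 1) ^ 2) (π : AlphaInputsT3AC.PolymerT3 F)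

/-- The v3 datum's large-field term unfolded: `Zterm^{(K)}_j(h) = Σ_{i<j} zcoefOf i · |Z_i(h)|` (definitional). [cite: Balaban1985UV3, (41) p.266] -/
theorem AlphaInputsT3AC.OfV3At.dataT3v3_Zterm_eq (K j : ℕ) (r : Hist (F.P K) j) :
    (h.dataT3v3 hc γ hγ hγ1 π).Zterm K j r =
      ∑ i ∈ Finset.range j, zcoefOf (T3Scales F γ hγ (hγ1.trans (sq_min_one_le _ 𝔠.gamma0_pos)) K) 𝔠.lane.carrier i *
        (ZVol 𝔠.lane.carrier.M₁ (rcolOf (T3Scales F γ hγ (hγ1.trans (sq_min_one_le _ 𝔠.gamma0_pos)) K) 𝔠.lane.carrier) j r i : ℝ) := rfl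

/-- **STUB 2″ CLAUSE (d) AT THE v3 DATUM — THE SIZE OF THE LARGE-FIELD TERM, PROVED with `κZ := 𝔠.Alf`**: for every run `K`, level `j ≤ K`, region history `r` and
fibre variable `v`, `0 ≤ Zterm_j(h) ≤ A·Σ_{i<j} (1 + log(√(γL^{−(K−i)}))⁻¹)·#{y ∈ T^{(i)} : toFine y ∉ Ω_{i+1}(h)}` with `h = assemble r v = r`,
`A = (C_z + C_v) + C₅ + C₆ + 3(|log σ₀| + d(𝔤))` — «Σ_{j<k} O(log g_j⁻¹)|Z_j|» of (41) p.266. [cite: Balaban1985UV3, (41) p.266] -/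
theorem AlphaInputsT3AC.OfV3At.dataT3v3_ztermSize (K j : ℕ) (r : (h.lfDataT3v3 hc γ hγ hγ1 π).Reg K j)
    (v : (i : Fin j) → GaugeField (F.P K) i (Matrix.specialUnitaryGroup (Fin 2) ℂ)) (hj : j ≤ K) :
    0 ≤ (h.dataT3v3 hc γ hγ hγ1 π).Zterm K j ((h.lfDataT3v3 hc γ hγ hγ1 π).assemble K j r v) ∧
    (h.dataT3v3 hc γ hγ hγ1 π).Zterm K j ((h.lfDataT3v3 hc γ hγ hγ1 π).assemble K j r v) ≤
      𝔠.Alf * ∑ i ∈ Finset.range j,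
        (1 + Real.log (Real.sqrt (γ * ((F.L : ℝ)⁻¹) ^ (K - i)))⁻¹) *
          (({y : Site (F.P K) i | toFine i y ∉ (h.dataT3v3 hc γ hγ hγ1 π).Ω K j
              ((h.lfDataT3v3 hc γ hγ hγ1 π).assemble K j r v) (i + 1)} : Set (Site (F.P K) i)).ncard : ℝ) := by
  have hγ1' : γ ≤ 1 := hγ1.trans (sq_min_one_le _ 𝔠.gamma0_pos)
  rw [h.lfDataT3v3_assemble_eq hc γ hγ hγ1 π, h.dataT3v3_Zterm_eq hc γ hγ hγ1 π, Finset.mul_sum]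
  refine ⟨Finset.sum_nonneg fun i hi => ?_, Finset.sum_le_sum fun i hi => ?_⟩
  · have hiK : i ≤ K := (Finset.mem_range.mp hi).le.trans hj
    exact mul_nonneg (𝔠.zcoefOf_nonneg_le (T3Scales F γ hγ hγ1' K) i hiK).1 (Nat.cast_nonneg _)
  · have hij : i < j := Finset.mem_range.mp hi
    have hiK : i ≤ K := hij.le.trans hj
    have hz := (𝔠.zcoefOf_nonneg_le (T3Scales F γ hγ hγ1' K) i hiK).2
    rw [T3Scales_gk_eq F γ hγ hγ1' K i hiK] at hz
    have hvol : (ZVol 𝔠.lane.carrier.M₁ (rcolOf (T3Scales F γ hγ hγ1' K) 𝔠.lane.carrier) j r i : ℝ) =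
        (({y : Site (F.P K) i | toFine i y ∉ (h.dataT3v3 hc γ hγ hγ1 π).Ω K j r (i + 1)} : Set (Site (F.P K) i)).ncard : ℝ) :=
      ZVol_eq_ncard _ _ j r i hij (by show i ≤ F.m + K; omega)
    rw [hvol, ← mul_assoc]
    exact mul_le_mul_of_nonneg_right hz (Nat.cast_nonneg _)

end Zterm

/-! ## §2 The (β) rows of the v3 record by name, for crux 19935's (A)-chain -/

section TrivRows

variable {F : T3Family} {𝔠 : AlphaConsts F.L (suGroupModel 2).N} {γ : ℝ} {hγ : 0 < γ} {hγ1 : γ ≤ (min 𝔠.gamma0 1) ^ 2} {K : ℕ}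
  (p : AlphaInputsT3AC.PkgAtV3 F 𝔠 γ hγ hγ1 K)

/-- The LOWER residual row at every step `k < K` of the v3 record, by projection. [cite: Balaban1985UV3, (47) p.267 + (57) p.270] -/
theorem AlphaInputsT3AC.PkgAtV3.fibre57Low (k : ℕ) (hk : k + 1 ≤ K) :
    Summit.QuantumFields.Balaban3D.Proofs.Bound55AC.Fibre57LowAC p.X 𝔠.lane.carrier p.𝔖 (fun _ => True) k (piecesWAC 𝔠.lane p.X p.𝔖 k) :=
  (p.run.steps k hk).fibre57Low

/-- **THE MASS-FREE TRIVIAL-HISTORY ROW OF THE v3 RECORD**, every step `k < K`: `T_k[χB_k(triv′)·e^{(41)_k-exponent at triv}] ≤ᵐ e^{(55)·(58)-exponent at triv′}` —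
the projected v3 row `fibre55Win` at `h′ = triv` through ★19201-p2's `LogComparisonRepAtHeights.fibre55Triv_of_fibre55WinAC` (`w_k(triv′) = 1`, `M(triv) = 1`,
`𝟙[window] ≤ 1`; the left window of R-g18-a COVERS `χB_k(triv′)` for the (40) windows, `AlphaInputsT3AC.wtP_admWindowT3_triv_eq_one`).  No transported trivial mass,
no Haar compatibility. [cite: Balaban1985UV3, (55) p.269 and p.272 L32-33] -/
theorem AlphaInputsT3AC.PkgAtV3.fibre55Triv (k : ℕ) (hk : k + 1 ≤ K) :
    (rnTransport (p.X.av k).avg (fun U =>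
        chiB 𝔠.lane.carrier.M₁ (rcolOf (T3Scales F γ hγ (hγ1.trans (sq_min_one_le _ 𝔠.gamma0_pos)) K) 𝔠.lane.carrier)
            (eps1Of (T3Scales F γ hγ (hγ1.trans (sq_min_one_le _ 𝔠.gamma0_pos)) K) 𝔠.lane.carrier) k (Hist.triv (F.P K) (k + 1)) U *
          Real.exp (-(p.T.mainT k (Hist.triv (F.P K) k) U) + p.T.Pint k (Hist.triv (F.P K) k) U - p.T.Ecst k
            + p.T.Zterm k (Hist.triv (F.P K) k) + p.T.Rm k)))
      ≤ᵐ[fieldMeasure (F.P K) (k + 1) (Matrix.specialUnitaryGroup (Fin 2) ℂ)] fun V =>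
        Real.exp (-(p.T.mainT (k + 1) (Hist.triv (F.P K) (k + 1)) V) - p.T.Ecst k
          + ((piecesAC 𝔠.lane p.X p.𝔖 k).logσ₀ + (piecesAC 𝔠.lane p.X p.𝔖 k).dg * Real.log (p.T.g k)) * (piecesAC 𝔠.lane p.X p.𝔖 k).starB (Hist.triv (F.P K) (k + 1))
          + (piecesAC 𝔠.lane p.X p.𝔖 k).logZU (Hist.triv (F.P K) (k + 1)) V + (piecesAC 𝔠.lane p.X p.𝔖 k).Pold (Hist.triv (F.P K) (k + 1)) V
          + p.T.Zterm k ((piecesAC 𝔠.lane p.X p.𝔖 k).proj (Hist.triv (F.P K) (k + 1))) + p.T.Rm k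
          + (piecesAC 𝔠.lane p.X p.𝔖 k).logFl (Hist.triv (F.P K) (k + 1)) V) :=
  LogComparisonRepAtHeights.fibre55Triv_of_fibre55WinAC 𝔠.lane p.X p.𝔖 (AlphaInputsT3AC.admWindowT3 F 𝔠 γ hγ hγ1 K) k
    (by show k ≤ F.m + K; omega) (p.fibre55Win k hk (Hist.triv (F.P K) (k + 1)))
    (fun U hU => AlphaInputsT3AC.wtP_admWindowT3_triv_eq_one hγ1 p.X k (by omega) U hU)

end TrivRows

section TrivRowsAt

variable {F : T3Family} {𝔠 : AlphaConsts F.L (suGroupModel 2).N} {a₀ a₁ : ℝ}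
  (h : AlphaInputsT3AC.OfV3At F 𝔠 a₀ a₁) (hc : 0 < a₀ ∧ 0 < a₁ ∧ 𝔠.B₃ * a₁ ≤ a₀) (γ : ℝ) (hγ : 0 < γ)
  (hγ1 : γ ≤ (min 𝔠.gamma0 1) ^ 2)

/-- **THE MASS-FREE TRIVIAL-HISTORY ROWS OF THE CHOSEN v3 RECORDS, EVERY RUN `K` AND STEP `k < K`** — the `hrow` hypothesis of ★19201-p2's
`OfV2At.repAtHeights_dataT3c_of_fibre55Triv` with `pkgAtV2 ↦ pkgAtV3`, now a THEOREM of the v3 socket. [cite: Balaban1985UV3, (55) p.269 and p.272 L32-33] -/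
theorem AlphaInputsT3AC.OfV3At.fibre55TrivRows (K k : ℕ) (hk : k + 1 ≤ K) :
    (rnTransport (((h.pkgAtV3 hc γ hγ hγ1 K).X).av k).avg (fun U =>
        chiB 𝔠.lane.carrier.M₁ (rcolOf (T3Scales F γ hγ (hγ1.trans (sq_min_one_le _ 𝔠.gamma0_pos)) K) 𝔠.lane.carrier)
            (eps1Of (T3Scales F γ hγ (hγ1.trans (sq_min_one_le _ 𝔠.gamma0_pos)) K) 𝔠.lane.carrier) k (Hist.triv (F.P K) (k + 1)) U *
          Real.exp (-((h.pkgAtV3 hc γ hγ hγ1 K).T.mainT k ((h.pkgAtV3 hc γ hγ hγ1 K).T.triv k) U)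
            + (h.pkgAtV3 hc γ hγ hγ1 K).T.Pint k ((h.pkgAtV3 hc γ hγ hγ1 K).T.triv k) U - (h.pkgAtV3 hc γ hγ hγ1 K).T.Ecst k
            + (h.pkgAtV3 hc γ hγ hγ1 K).T.Zterm k ((h.pkgAtV3 hc γ hγ hγ1 K).T.triv k) + (h.pkgAtV3 hc γ hγ hγ1 K).T.Rm k)))
      ≤ᵐ[fieldMeasure (F.P K) (k + 1) (Matrix.specialUnitaryGroup (Fin 2) ℂ)] fun V =>
        Real.exp (-((h.pkgAtV3 hc γ hγ hγ1 K).T.mainT (k + 1) ((h.pkgAtV3 hc γ hγ hγ1 K).T.triv (k + 1)) V) - (h.pkgAtV3 hc γ hγ hγ1 K).T.Ecst k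
          + ((piecesAC 𝔠.lane (h.pkgAtV3 hc γ hγ hγ1 K).X (h.pkgAtV3 hc γ hγ hγ1 K).𝔖 k).logσ₀
              + (piecesAC 𝔠.lane (h.pkgAtV3 hc γ hγ hγ1 K).X (h.pkgAtV3 hc γ hγ hγ1 K).𝔖 k).dg *
                Real.log ((T3Scales F γ hγ (hγ1.trans (sq_min_one_le _ 𝔠.gamma0_pos)) K).gk k)) *
              (piecesAC 𝔠.lane (h.pkgAtV3 hc γ hγ hγ1 K).X (h.pkgAtV3 hc γ hγ hγ1 K).𝔖 k).starB ((h.pkgAtV3 hc γ hγ hγ1 K).T.triv (k + 1))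
          + (piecesAC 𝔠.lane (h.pkgAtV3 hc γ hγ hγ1 K).X (h.pkgAtV3 hc γ hγ hγ1 K).𝔖 k).logZU ((h.pkgAtV3 hc γ hγ hγ1 K).T.triv (k + 1)) V
          + (piecesAC 𝔠.lane (h.pkgAtV3 hc γ hγ hγ1 K).X (h.pkgAtV3 hc γ hγ hγ1 K).𝔖 k).Pold ((h.pkgAtV3 hc γ hγ hγ1 K).T.triv (k + 1)) V
          + (h.pkgAtV3 hc γ hγ hγ1 K).T.Zterm k ((piecesAC 𝔠.lane (h.pkgAtV3 hc γ hγ hγ1 K).X (h.pkgAtV3 hc γ hγ hγ1 K).𝔖 k).proj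
              ((h.pkgAtV3 hc γ hγ hγ1 K).T.triv (k + 1))) + (h.pkgAtV3 hc γ hγ hγ1 K).T.Rm k
          + (piecesAC 𝔠.lane (h.pkgAtV3 hc γ hγ hγ1 K).X (h.pkgAtV3 hc γ hγ hγ1 K).𝔖 k).logFl ((h.pkgAtV3 hc γ hγ hγ1 K).T.triv (k + 1)) V) :=
  (h.pkgAtV3 hc γ hγ hγ1 K).fibre55Triv k hk

end TrivRowsAt

end Summit.QuantumFields.YangMills.Theorems

end
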